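import Summits.ValiantsHypothesis.ValiantsHypothesis.Theorems.LacunarySymmetroidMatrixDescartesDoorA26WallBubblingThreeScaleTriple
import Summits.ValiantsHypothesis.ValiantsHypothesis.Theorems.LacunarySymmetroidMatrixDescartesDoorA26WallBubblingTwoPairTripleMid

/-!
# Wall bubbling for `DoorA26` — TWO WEYL PAIRS, rung 5: THE PURE CLASSES `2δ₀`, `2δ₁` ACROSS THREE SCALES

HONEST FRAMING.  Chain lemma for obligation (W) `stub_weylFaces` of `Cruxes/DoorA26/Lines/wall_bubbling.lean` (stmt-ValiantsHypothesis-19979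
`DoorA26`; OPEN, typed, never asserted), W1 seat val-sym-door-p2 g13 (#50a, pair `(0,5)`) — rung 5 of the two-dslope port plan
`HOME/val-sym-door-p2/g13/TWO-DSLOPE-CHAIN-PORT.md`.  W2's `threeScale_triple` (door-p1 g15) VERBATIM for the two-dslope frames (W1 #25/#45/#46):
**`twoPair_threeScale_triple₀₅`** — `Γ₁ 0 5 ≠ 0 → Γ₂ 0 5 ≠ 0 → Γ₃ 0 5 ≠ 0 → False`; **`twoPair_threeScale_triple₁₄`** — the same for `(1,4)`
(three clusters at log-distances `L₁`, `L₁ + L₂`); scalar core W2's `three_opposite_core`, nested transvections W2's `dslope_exp_shift_sub`, stage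
identities W2's `triple_frameShift` / W1 #48 `triple_frameShift₁₄`.  With W1 #46–#50 all five of W2's rungs hold at two-Weyl-pair points for the
pure classes and the doubletons; the chains hC1/hC2/hVG2 (W1 #43/#44) still need the NEW mixed-class rungs for `δ₀+δ₁` (memo §2), the
cluster-currency transport and the assembly.  No new definitions; nothing on `DoorA26`, `MatrixDescartes` (18050) or `VP ≠ VNP`.
`--supports stmt-ValiantsHypothesis-19979 --as helper`.  [this work = W2's rung 5, re-framed].
-/

-- `Summit.ValiantsHypothesis.ValiantsHypothesis.…` repeats a component by the D-0017 layout
-- (single-conjunct summit), which the `dupNamespace` linter flags; the name is mandated.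
set_option linter.dupNamespace false

namespace Summit.ValiantsHypothesis.ValiantsHypothesis.Theorems.LacunarySymmetroidMatrixDescartes.WallBubbling

open Finset Filter Topology
open Bubbling (polar polar_apply polar_comm polar_smul_left_right)
open scoped BigOperators

/-- **THE CLASS `2δ₀` ACROSS THREE SCALES (two Weyl pairs).**  The `t`-slot `(0,5)` is not alive at three clusters. [this work = W2's rung 5,
re-framed] -/
theorem twoPair_threeScale_triple₀₅ (δs : ℕ → Fin 6 → ℝ) (δ0 : Fin 6 → ℝ)
    (hδ : ∀ l, Tendsto (fun ν => δs ν l) atTop (𝓝 (δ0 l))) (h50 : δ0 5 = δ0 0)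
    (U : ℕ → Fin 6 → Matrix (Fin 2) (Fin 2) ℝ) (L₁ L₂ : ℕ → ℝ) (hL₁ : Tendsto L₁ atTop atTop) (hL₂ : Tendsto L₂ atTop atTop)
    (μ₁ μ₂ μ₃ : ℕ → ℝ) (hμ₁ : ∀ ν, 0 < μ₁ ν) (hμ₂ : ∀ ν, 0 < μ₂ ν) (hμ₃ : ∀ ν, 0 < μ₃ ν)
    (hdom₁ : ∀ ν a b, |polar (if a = 0 then U ν 0 + U ν 5 else if a = 1 then U ν 1 + U ν 4
        else if a = 4 then (δs ν 4 - δs ν 1) • U ν 4 else if a = 5 then (δs ν 5 - δs ν 0) • U ν 5 else U ν a)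
      (if b = 0 then U ν 0 + U ν 5 else if b = 1 then U ν 1 + U ν 4
        else if b = 4 then (δs ν 4 - δs ν 1) • U ν 4 else if b = 5 then (δs ν 5 - δs ν 0) • U ν 5 else U ν b)| ≤ μ₁ ν)
    (hdom₂ : ∀ ν a b, |polar
      (if a = 0 then Real.exp (δs ν 0 * L₁ ν) • U ν 0 + Real.exp (δs ν 5 * L₁ ν) • U ν 5
        else if a = 1 then Real.exp (δs ν 1 * L₁ ν) • U ν 1 + Real.exp (δs ν 4 * L₁ ν) • U ν 4
        else if a = 4 then (δs ν 4 - δs ν 1) • (Real.exp (δs ν 4 * L₁ ν) • U ν 4)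
        else if a = 5 then (δs ν 5 - δs ν 0) • (Real.exp (δs ν 5 * L₁ ν) • U ν 5) else Real.exp (δs ν a * L₁ ν) • U ν a)
      (if b = 0 then Real.exp (δs ν 0 * L₁ ν) • U ν 0 + Real.exp (δs ν 5 * L₁ ν) • U ν 5
        else if b = 1 then Real.exp (δs ν 1 * L₁ ν) • U ν 1 + Real.exp (δs ν 4 * L₁ ν) • U ν 4
        else if b = 4 then (δs ν 4 - δs ν 1) • (Real.exp (δs ν 4 * L₁ ν) • U ν 4)
        else if b = 5 then (δs ν 5 - δs ν 0) • (Real.exp (δs ν 5 * L₁ ν) • U ν 5) else Real.exp (δs ν b * L₁ ν) • U ν b)| ≤ μ₂ ν)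
    (hdom₃ : ∀ ν a b, |polar
      (if a = 0 then Real.exp (δs ν 0 * (L₁ ν + L₂ ν)) • U ν 0 + Real.exp (δs ν 5 * (L₁ ν + L₂ ν)) • U ν 5
        else if a = 1 then Real.exp (δs ν 1 * (L₁ ν + L₂ ν)) • U ν 1 + Real.exp (δs ν 4 * (L₁ ν + L₂ ν)) • U ν 4
        else if a = 4 then (δs ν 4 - δs ν 1) • (Real.exp (δs ν 4 * (L₁ ν + L₂ ν)) • U ν 4)
        else if a = 5 then (δs ν 5 - δs ν 0) • (Real.exp (δs ν 5 * (L₁ ν + L₂ ν)) • U ν 5) else Real.exp (δs ν a * (L₁ ν + L₂ ν)) • U ν a)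
      (if b = 0 then Real.exp (δs ν 0 * (L₁ ν + L₂ ν)) • U ν 0 + Real.exp (δs ν 5 * (L₁ ν + L₂ ν)) • U ν 5
        else if b = 1 then Real.exp (δs ν 1 * (L₁ ν + L₂ ν)) • U ν 1 + Real.exp (δs ν 4 * (L₁ ν + L₂ ν)) • U ν 4
        else if b = 4 then (δs ν 4 - δs ν 1) • (Real.exp (δs ν 4 * (L₁ ν + L₂ ν)) • U ν 4)
        else if b = 5 then (δs ν 5 - δs ν 0) • (Real.exp (δs ν 5 * (L₁ ν + L₂ ν)) • U ν 5) else Real.exp (δs ν b * (L₁ ν + L₂ ν)) • U ν b)| ≤ μ₃ ν)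
    (Γ₁ Γ₂ Γ₃ : Fin 6 → Fin 6 → ℝ)
    (hΓ₁ : ∀ a b, Tendsto (fun ν => polar (if a = 0 then U ν 0 + U ν 5 else if a = 1 then U ν 1 + U ν 4
        else if a = 4 then (δs ν 4 - δs ν 1) • U ν 4 else if a = 5 then (δs ν 5 - δs ν 0) • U ν 5 else U ν a)
      (if b = 0 then U ν 0 + U ν 5 else if b = 1 then U ν 1 + U ν 4
        else if b = 4 then (δs ν 4 - δs ν 1) • U ν 4 else if b = 5 then (δs ν 5 - δs ν 0) • U ν 5 else U ν b) / μ₁ ν) atTop (𝓝 (Γ₁ a b)))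
    (hΓ₂ : ∀ a b, Tendsto (fun ν => polar
      (if a = 0 then Real.exp (δs ν 0 * L₁ ν) • U ν 0 + Real.exp (δs ν 5 * L₁ ν) • U ν 5
        else if a = 1 then Real.exp (δs ν 1 * L₁ ν) • U ν 1 + Real.exp (δs ν 4 * L₁ ν) • U ν 4
        else if a = 4 then (δs ν 4 - δs ν 1) • (Real.exp (δs ν 4 * L₁ ν) • U ν 4)
        else if a = 5 then (δs ν 5 - δs ν 0) • (Real.exp (δs ν 5 * L₁ ν) • U ν 5) else Real.exp (δs ν a * L₁ ν) • U ν a)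
      (if b = 0 then Real.exp (δs ν 0 * L₁ ν) • U ν 0 + Real.exp (δs ν 5 * L₁ ν) • U ν 5
        else if b = 1 then Real.exp (δs ν 1 * L₁ ν) • U ν 1 + Real.exp (δs ν 4 * L₁ ν) • U ν 4
        else if b = 4 then (δs ν 4 - δs ν 1) • (Real.exp (δs ν 4 * L₁ ν) • U ν 4)
        else if b = 5 then (δs ν 5 - δs ν 0) • (Real.exp (δs ν 5 * L₁ ν) • U ν 5) else Real.exp (δs ν b * L₁ ν) • U ν b) / μ₂ ν)
      atTop (𝓝 (Γ₂ a b)))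
    (hΓ₃ : ∀ a b, Tendsto (fun ν => polar
      (if a = 0 then Real.exp (δs ν 0 * (L₁ ν + L₂ ν)) • U ν 0 + Real.exp (δs ν 5 * (L₁ ν + L₂ ν)) • U ν 5
        else if a = 1 then Real.exp (δs ν 1 * (L₁ ν + L₂ ν)) • U ν 1 + Real.exp (δs ν 4 * (L₁ ν + L₂ ν)) • U ν 4
        else if a = 4 then (δs ν 4 - δs ν 1) • (Real.exp (δs ν 4 * (L₁ ν + L₂ ν)) • U ν 4)
        else if a = 5 then (δs ν 5 - δs ν 0) • (Real.exp (δs ν 5 * (L₁ ν + L₂ ν)) • U ν 5) else Real.exp (δs ν a * (L₁ ν + L₂ ν)) • U ν a)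
      (if b = 0 then Real.exp (δs ν 0 * (L₁ ν + L₂ ν)) • U ν 0 + Real.exp (δs ν 5 * (L₁ ν + L₂ ν)) • U ν 5
        else if b = 1 then Real.exp (δs ν 1 * (L₁ ν + L₂ ν)) • U ν 1 + Real.exp (δs ν 4 * (L₁ ν + L₂ ν)) • U ν 4
        else if b = 4 then (δs ν 4 - δs ν 1) • (Real.exp (δs ν 4 * (L₁ ν + L₂ ν)) • U ν 4)
        else if b = 5 then (δs ν 5 - δs ν 0) • (Real.exp (δs ν 5 * (L₁ ν + L₂ ν)) • U ν 5) else Real.exp (δs ν b * (L₁ ν + L₂ ν)) • U ν b) / μ₃ ν)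
      atTop (𝓝 (Γ₃ a b)))
    (h1 : Γ₁ 0 5 ≠ 0) (h2 : Γ₂ 0 5 ≠ 0) (h3 : Γ₃ 0 5 ≠ 0) : False := by
  set κ₁ : ℝ := |Γ₁ 0 5| / 2 with hκ₁
  set κ₂ : ℝ := |Γ₂ 0 5| / 2 with hκ₂
  set κ₃ : ℝ := |Γ₃ 0 5| / 2 with hκ₃
  have hκ₁pos : 0 < κ₁ := by rw [hκ₁]; exact half_pos (abs_pos.mpr h1)
  have hκ₂pos : 0 < κ₂ := by rw [hκ₂]; exact half_pos (abs_pos.mpr h2)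
  have hκ₃pos : 0 < κ₃ := by rw [hκ₃]; exact half_pos (abs_pos.mpr h3)
  have f50 : ((5 : Fin 6) = 0) = False := by simp
  have f51 : ((5 : Fin 6) = 1) = False := by simp
  have f54 : ((5 : Fin 6) = 4) = False := by simp
  have f01 : ((0 : Fin 6) = 1) = False := by simp
  have f04 : ((0 : Fin 6) = 4) = False := by simp
  have f05 : ((0 : Fin 6) = 5) = False := by simp
  have hw0 : Tendsto (fun ν => δs ν 5 - δs ν 0) atTop (𝓝 0) := by
    have := (hδ 5).sub (hδ 0)
    rw [h50, sub_self] at this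
    exact this
  have hL₃ : Tendsto (fun ν => L₁ ν + L₂ ν) atTop atTop := hL₁.atTop_add_atTop hL₂
  -- aliveness at the three scales
  have e1 : ∀ᶠ ν in atTop, κ₁ * μ₁ ν ≤ |polar (U ν 0 + U ν 5) ((δs ν 5 - δs ν 0) • U ν 5)| := by
    have h := ((hΓ₁ 0 5).abs).eventually_const_lt (show κ₁ < |Γ₁ 0 5| by rw [hκ₁]; linarith [abs_pos.mpr h1])
    filter_upwards [h] with ν hν
    simp only [f50, f51, f54, f01, f04, f05, if_false, if_true] at hν
    rw [abs_div, abs_of_pos (hμ₁ ν), lt_div_iff₀ (hμ₁ ν)] at hν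
    exact hν.le
  have e2 : ∀ᶠ ν in atTop, κ₂ * μ₂ ν ≤ |polar (Real.exp (δs ν 0 * L₁ ν) • U ν 0 + Real.exp (δs ν 5 * L₁ ν) • U ν 5)
      ((δs ν 5 - δs ν 0) • (Real.exp (δs ν 5 * L₁ ν) • U ν 5))| := by
    have h := ((hΓ₂ 0 5).abs).eventually_const_lt (show κ₂ < |Γ₂ 0 5| by rw [hκ₂]; linarith [abs_pos.mpr h2])
    filter_upwards [h] with ν hν
    simp only [f50, f51, f54, f01, f04, f05, if_false, if_true] at hν
    rw [abs_div, abs_of_pos (hμ₂ ν), lt_div_iff₀ (hμ₂ ν)] at hν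
    exact hν.le
  have e3 : ∀ᶠ ν in atTop, κ₃ * μ₃ ν ≤ |polar (Real.exp (δs ν 0 * (L₁ ν + L₂ ν)) • U ν 0 + Real.exp (δs ν 5 * (L₁ ν + L₂ ν)) • U ν 5)
      ((δs ν 5 - δs ν 0) • (Real.exp (δs ν 5 * (L₁ ν + L₂ ν)) • U ν 5))| := by
    have h := ((hΓ₃ 0 5).abs).eventually_const_lt (show κ₃ < |Γ₃ 0 5| by rw [hκ₃]; linarith [abs_pos.mpr h3])
    filter_upwards [h] with ν hν
    simp only [f50, f51, f54, f01, f04, f05, if_false, if_true] at hν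
    rw [abs_div, abs_of_pos (hμ₃ ν), lt_div_iff₀ (hμ₃ ν)] at hν
    exact hν.le
  -- the six growth conditions on the transvection coefficients
  have g2a : ∀ᶠ ν in atTop, 0 * Real.exp ((δs ν 5 - δs ν 0) * L₁ ν) + 8 / κ₁
      < |dslope (fun y : ℝ => Real.exp (y * L₁ ν)) 0 (δs ν 5 - δs ν 0)| :=
    eventually_dslope_exp_gt (fun ν => δs ν 5 - δs ν 0) L₁ hw0 hL₁ 0 (8 / κ₁) le_rfl (by positivity)
  have g2b : ∀ᶠ ν in atTop, 8 / κ₂ * Real.exp ((δs ν 5 - δs ν 0) * L₁ ν) + 0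
      < |dslope (fun y : ℝ => Real.exp (y * L₁ ν)) 0 (δs ν 5 - δs ν 0)| :=
    eventually_dslope_exp_gt (fun ν => δs ν 5 - δs ν 0) L₁ hw0 hL₁ (8 / κ₂) 0 (by positivity) le_rfl
  have g3a : ∀ᶠ ν in atTop, 0 * Real.exp ((δs ν 5 - δs ν 0) * (L₁ ν + L₂ ν)) + 8 / κ₁
      < |dslope (fun y : ℝ => Real.exp (y * (L₁ ν + L₂ ν))) 0 (δs ν 5 - δs ν 0)| :=
    eventually_dslope_exp_gt (fun ν => δs ν 5 - δs ν 0) (fun ν => L₁ ν + L₂ ν) hw0 hL₃ 0 (8 / κ₁) le_rfl (by positivity)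
  have g3b : ∀ᶠ ν in atTop, 8 / κ₃ * Real.exp ((δs ν 5 - δs ν 0) * (L₁ ν + L₂ ν)) + 0
      < |dslope (fun y : ℝ => Real.exp (y * (L₁ ν + L₂ ν))) 0 (δs ν 5 - δs ν 0)| :=
    eventually_dslope_exp_gt (fun ν => δs ν 5 - δs ν 0) (fun ν => L₁ ν + L₂ ν) hw0 hL₃ (8 / κ₃) 0 (by positivity) le_rfl
  have gDa : ∀ᶠ ν in atTop, 0 * Real.exp ((δs ν 5 - δs ν 0) * L₂ ν) + 8 / κ₂
      < |dslope (fun y : ℝ => Real.exp (y * L₂ ν)) 0 (δs ν 5 - δs ν 0)| :=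
    eventually_dslope_exp_gt (fun ν => δs ν 5 - δs ν 0) L₂ hw0 hL₂ 0 (8 / κ₂) le_rfl (by positivity)
  have gDb : ∀ᶠ ν in atTop, 8 / κ₃ * Real.exp ((δs ν 5 - δs ν 0) * L₂ ν) + 0
      < |dslope (fun y : ℝ => Real.exp (y * L₂ ν)) 0 (δs ν 5 - δs ν 0)| :=
    eventually_dslope_exp_gt (fun ν => δs ν 5 - δs ν 0) L₂ hw0 hL₂ (8 / κ₃) 0 (by positivity) le_rfl
  have hfalse : ∀ᶠ ν : ℕ in atTop, False := by
    filter_upwards [e1, e2, e3, g2a, g2b, g3a, g3b, gDa, gDb] with ν hν1 hν2 hν3 q2a q2b q3a q3b qDa qDb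
    obtain ⟨-, i05₂, i00₂⟩ := triple_frameShift (δs ν) (U ν) (L₁ ν)
    obtain ⟨-, i05₃, i00₃⟩ := triple_frameShift (δs ν) (U ν) (L₁ ν + L₂ ν)
    set w := δs ν 5 - δs ν 0 with hw
    set g55 := polar (w • U ν 5) (w • U ν 5) with hg55
    set g05 := polar (U ν 0 + U ν 5) (w • U ν 5) with hg05
    set g00 := polar (U ν 0 + U ν 5) (U ν 0 + U ν 5) with hg00
    set Λ₂ := dslope (fun y : ℝ => Real.exp (y * L₁ ν)) 0 w with hΛ₂
    set Λ₃ := dslope (fun y : ℝ => Real.exp (y * (L₁ ν + L₂ ν))) 0 w with hΛ₃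
    set D := dslope (fun y : ℝ => Real.exp (y * L₂ ν)) 0 w with hD
    set E₂ := Real.exp (δs ν 0 * L₁ ν) with hE₂
    set E₃ := Real.exp (δs ν 0 * (L₁ ν + L₂ ν)) with hE₃
    set e₂ := Real.exp (w * L₁ ν) with he₂
    set e₃ := Real.exp (w * (L₁ ν + L₂ ν)) with he₃
    set d := Real.exp (w * L₂ ν) with hd
    have hE₂pos : 0 < E₂ := Real.exp_pos _
    have hE₃pos : 0 < E₃ := Real.exp_pos _
    have he₂pos : 0 < e₂ := Real.exp_pos _
    have he₃pos : 0 < e₃ := Real.exp_pos _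
    have hdpos : 0 < d := Real.exp_pos _
    have h00le : |g00| ≤ μ₁ ν := by have := hdom₁ ν 0 0; simp only [f01, f04, f05, if_false, if_true] at this; exact this
    -- cluster 2: κ₂ |g00^{(2)}| ≤ |g05^{(2)}|, with the E² factors divided out
    have c2 : κ₂ * |g00 + 2 * Λ₂ * g05 + Λ₂ * Λ₂ * g55| ≤ e₂ * |g05 + Λ₂ * g55| := by
      have hd00 := hdom₂ ν 0 0
      simp only [f01, f04, f05, if_false, if_true] at hd00
      rw [i00₂, abs_mul, abs_of_pos (mul_pos hE₂pos hE₂pos)] at hd00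
      rw [i05₂, abs_mul, abs_of_pos (by positivity)] at hν2
      have : (κ₂ * |g00 + 2 * Λ₂ * g05 + Λ₂ * Λ₂ * g55|) * (E₂ * E₂) ≤ (e₂ * |g05 + Λ₂ * g55|) * (E₂ * E₂) := by
        calc (κ₂ * |g00 + 2 * Λ₂ * g05 + Λ₂ * Λ₂ * g55|) * (E₂ * E₂) = κ₂ * (E₂ * E₂ * |g00 + 2 * Λ₂ * g05 + Λ₂ * Λ₂ * g55|) := by ring
          _ ≤ κ₂ * μ₂ ν := mul_le_mul_of_nonneg_left hd00 hκ₂pos.le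
          _ ≤ E₂ * E₂ * e₂ * |g05 + Λ₂ * g55| := hν2
          _ = (e₂ * |g05 + Λ₂ * g55|) * (E₂ * E₂) := by ring
      exact le_of_mul_le_mul_right this (by positivity)
    have c3 : κ₃ * |g00 + 2 * Λ₃ * g05 + Λ₃ * Λ₃ * g55| ≤ e₃ * |g05 + Λ₃ * g55| := by
      have hd00 := hdom₃ ν 0 0
      simp only [f01, f04, f05, if_false, if_true] at hd00
      rw [i00₃, abs_mul, abs_of_pos (mul_pos hE₃pos hE₃pos)] at hd00
      rw [i05₃, abs_mul, abs_of_pos (by positivity)] at hν3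
      have : (κ₃ * |g00 + 2 * Λ₃ * g05 + Λ₃ * Λ₃ * g55|) * (E₃ * E₃) ≤ (e₃ * |g05 + Λ₃ * g55|) * (E₃ * E₃) := by
        calc (κ₃ * |g00 + 2 * Λ₃ * g05 + Λ₃ * Λ₃ * g55|) * (E₃ * E₃) = κ₃ * (E₃ * E₃ * |g00 + 2 * Λ₃ * g05 + Λ₃ * Λ₃ * g55|) := by ring
          _ ≤ κ₃ * μ₃ ν := mul_le_mul_of_nonneg_left hd00 hκ₃pos.le
          _ ≤ E₃ * E₃ * e₃ * |g05 + Λ₃ * g55| := hν3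
          _ = (e₃ * |g05 + Λ₃ * g55|) * (E₃ * E₃) := by ring
      exact le_of_mul_le_mul_right this (by positivity)
    -- the nested-shift identity and `e₃ = e₂ d`
    have hDrel : Λ₃ - Λ₂ = e₂ * D := dslope_exp_shift_sub (L₁ ν) (L₂ ν) w
    have he₃eq : e₃ = e₂ * d := by rw [he₃, he₂, hd, ← Real.exp_add]; congr 1; ring
    -- growth bounds in the form the core wants
    rw [zero_mul, zero_add] at q2a q3a qDa
    rw [add_zero] at q2b q3b qDb
    have b2a : 8 ≤ κ₁ * |Λ₂| := by
      have := mul_le_mul_of_nonneg_left q2a.le hκ₁pos.le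
      rw [show κ₁ * (8 / κ₁) = 8 by field_simp] at this; exact this
    have b2b : 8 * e₂ ≤ κ₂ * |Λ₂| := by
      have := mul_le_mul_of_nonneg_left q2b.le hκ₂pos.le
      rw [show κ₂ * (8 / κ₂ * e₂) = 8 * e₂ by field_simp] at this; exact this
    have b3a : 8 ≤ κ₁ * |Λ₃| := by
      have := mul_le_mul_of_nonneg_left q3a.le hκ₁pos.le
      rw [show κ₁ * (8 / κ₁) = 8 by field_simp] at this; exact this
    have b3b : 8 * e₃ ≤ κ₃ * |Λ₃| := by
      have := mul_le_mul_of_nonneg_left q3b.le hκ₃pos.le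
      rw [show κ₃ * (8 / κ₃ * e₃) = 8 * e₃ by field_simp] at this; exact this
    have bDa : 8 * e₂ ≤ κ₂ * |e₂ * D| := by
      have h8 := mul_le_mul_of_nonneg_left qDa.le hκ₂pos.le
      rw [show κ₂ * (8 / κ₂) = 8 by field_simp] at h8
      rw [abs_mul, abs_of_pos he₂pos]
      calc 8 * e₂ = e₂ * 8 := by ring
        _ ≤ e₂ * (κ₂ * |D|) := mul_le_mul_of_nonneg_left h8 he₂pos.le
        _ = κ₂ * (e₂ * |D|) := by ring
    have bDb : 8 * e₃ ≤ κ₃ * |e₂ * D| := by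
      have h8 := mul_le_mul_of_nonneg_left qDb.le hκ₃pos.le
      rw [show κ₃ * (8 / κ₃ * d) = 8 * d by field_simp] at h8
      rw [abs_mul, abs_of_pos he₂pos, he₃eq]
      calc 8 * (e₂ * d) = e₂ * (8 * d) := by ring
        _ ≤ e₂ * (κ₃ * |D|) := mul_le_mul_of_nonneg_left h8 he₂pos.le
        _ = κ₃ * (e₂ * |D|) := by ring
    exact three_opposite_core hκ₁pos hκ₂pos hκ₃pos (hμ₁ ν) he₂pos hν1 h00le c2 c3 hDrel b2a b2b b3a b3b bDa bDb
  exact hfalse.exists.elim fun _ h => h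

end Summit.ValiantsHypothesis.ValiantsHypothesis.Theorems.LacunarySymmetroidMatrixDescartes.WallBubbling
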